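import Summits.QuantumFields.QCD.Theses.FemtoStepScaling

/-!
# Birth skeleton (BC3) — crux `FiniteVolumeContinuumLimitC`
route `route-QuantumFields-FemtoStepScaling`, item `stmt-QuantumFields-17664`, sub-problem `QCD`.
Registrar: planner-skel-stmt-QuantumFields-17664-0 (2026-08-17). Tree path
`Summits/QuantumFields/QCD/Cruxes/FiniteVolumeContinuumLimitC/Lines/birth.lean`.

The crux (rank 5, "the step-scaling function exists, on a chirally pinned regularisation"): for
`N_f ∈ {2,3}` there is ONE mass-independent regularisation `reg`, good (mass scaling, two-loop
asymptotic scaling, `m_crit(k) > −1` eventually) and CHIRAL AT ZERO, such that for every positive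
renormalised mass tuple the renormalised, smeared composite-field correlators (pairwise-disjoint
supports) converge on EVERY physical 4-torus of side `ℓ ≥ ℓ₀`, with the non-degeneracy witnesses
N1 (glue two-point), N2 (every flavour-changing pseudoscalar propagates), N3 (glue `κ₃ ≠ 0`).

## The cut (the route's own two-layer plan: FemtoContinuumLimit ∘ ChiralPin | StepExtension)

* `stub_femtoWindowPinned` — BASE OCTAVE + PIN. A good regularisation, chiral at zero, whose
  renormalised correlators converge on the tori of ONE OCTAVE of physical sides `ℓ ∈ [ℓ₀, 2ℓ₀]`
  (`ℓ₀ = ℓ₀(m) > 0` at the producer's disposal — intended FEMTO, `ℓ₀Λ ≪ 1`, every mode weakly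
  coupled: Lüscher 1983 / van Baal–Koller small-volume expansion made a-uniform), the witnesses
  N1–N3 being read AT `ℓ₀`. Carries the whole IR content of the crux (the pin `IsChiralAtZero`:
  only the item that chooses `m_crit(k)` can place it at/below the Wilson critical line) and only
  the perturbative-regime part of its UV content.
* `stub_volumeDoubling` — THE STEP `ℓ ↦ 2ℓ`. For ANY good regularisation, positive mass tuple and
  renormalisation constants `(z, shift)`: if all disjoint-support smeared correlators converge on
  the torus of physical side `ℓ > 0`, then — with the SAME `(z, shift)` — they converge on the
  torus of side `2ℓ` (to some limit functional). Renormalisation is local, hence volume-blind; the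
  content is a-uniform control of the `2⁴`-times larger box at the stronger box-scale coupling
  `g²(2ℓ)` (large fields / box-scale strong coupling: the part of the UV problem that is "beyond
  Bałaban's stability theorems", barrier `UVStabilityNonUniqueness`). No pin, no non-degeneracy,
  no existence claim: a pure transfer statement, stated `∀ ℓ ℓ', ℓ' = 2ℓ → …` (let-via-∀).
* `FiniteVolumeContinuumLimitC_of` — kernel-checked composition: dyadic induction (octave
  `[2^j ℓ₀, 2^(j+1) ℓ₀]` by `j` doublings of `ℓ/2^j`-data, limit functionals glued by choice),
  Archimedean cover of `[ℓ₀, ∞)` by octaves (`exists_nat_pow_near`), N1–N3 transported at `ℓ₀`.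

Both stubs are stated over existing declarations only (verbatim sub-clauses of the route decl).
Neither is the crux: the first lacks every torus beyond one octave, the second produces no
regularisation, no pin and no witness (BC3 probes `stub → crux`, `stub → QCD` by
`exact? | simpa | aesop` fail — see the registrar's NOTES / evidence note).
-/

namespace Summit.QuantumFields.QCD.Cruxes.FiniteVolumeContinuumLimitC.Birth

open scoped BigOperators
open Filter

/-- **Stub 1 — femto base octave on a chirally pinned regularisation** (FemtoContinuumLimit ∘
ChiralPin of the route's two-layer plan). For `N_f ∈ {2,3}` there is a regularisation `reg` with
mass scaling, two-loop asymptotic scaling and `m_crit(k) > −1` eventually, CHIRAL AT ZERO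
(`reg.IsChiralAtZero`: the uniform lattice gap closes as `m → 0⁺` — `m_crit` at/below the Wilson
critical line; lattice Goldstone upper bound, the IR half of the crux), such that for every
positive mass tuple `m` there are species renormalisations `z, shift`, a limit functional `W` and a
scale `ℓ₀ > 0` (intended femto, `ℓ₀Λ ≪ 1`) with: (octave) for every `ℓ ∈ [ℓ₀, 2ℓ₀]` the smeared
renormalised `n`-point functions with pairwise-disjoint supports converge on the torus of side
`2⌊ℓ/2a_k⌋+1` to `W ℓ n σ f`; (N2 at `ℓ₀`) every flavour-changing `pseudoRe f g` has a
time-separated connected two-point value `≠ 0`; (N1, N3 at `ℓ₀`) glue has a time-separated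
connected two-point value `≠ 0` and a pairwise-disjoint connected three-point value `≠ 0`.
Why plausibly true: in a femto box every non-constant mode is perturbative and the constant modes
are a finite-dimensional problem (Lüscher 1983; Koller–van Baal 1986), so a-uniform bounds +
equicontinuity of renormalised correlators are within reach of Bałaban-type small-field
expansions; the pin is the Statement's own clause. Size: XL (UV at weak coupling + the lattice
Goldstone bound). Leans on: `QCDRegularisation.IsChiralAtZero`, `qcdTorusExpect`, `insertion`,
`QCDRegularisation.scheme`, `afBeta`, `box`, `siteToE` (tree); Balaban1987RG1,
Balaban1989LargeFieldII, Luscher1983, doi:10.1016/0550-3213(86)90252-x, MontvayMunster1994 §5.1. -/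
theorem stub_femtoWindowPinned :
    ∀ Nf : ℕ, 2 ≤ Nf → Nf ≤ 3 → ∃ reg : Literature.MathematicalPhysics.QuantumFieldTheory.QCDRegularisation Nf, (reg.HasMassScaling ∧ (∃ Λ > 0, Tendsto (fun k => reg.β k - Literature.MathematicalPhysics.QuantumFieldTheory.afBeta Nf Λ (reg.a k)) atTop (nhds 0)) ∧ (∀ᶠ k in atTop, (-1 : ℝ) < reg.mcrit k)) ∧ reg.IsChiralAtZero ∧ (∀ m : Fin Nf → ℝ, (∀ fl, 0 < m fl) → ∃ z shift : Literature.MathematicalPhysics.QuantumFieldTheory.QCDField Nf → ℕ → ℝ, ∃ W : ((ℓ : ℝ) → (n : ℕ) → (Fin n → Literature.MathematicalPhysics.QuantumFieldTheory.QCDField Nf) → (Fin n → SchwartzMap (EuclideanSpace ℝ (Fin 4)) ℝ) → ℂ), ∃ ℓ₀ > 0, (∀ ℓ : ℝ, ℓ₀ ≤ ℓ → ℓ ≤ 2 * ℓ₀ → ∀ (n : ℕ) (σ : Fin n → Literature.MathematicalPhysics.QuantumFieldTheory.QCDField Nf) (f : Fin n → SchwartzMap (EuclideanSpace ℝ (Fin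 4)) ℝ), (∀ i j : Fin n, i ≠ j → Disjoint (tsupport (f i)) (tsupport (f j))) → Tendsto (fun k => Literature.MathematicalPhysics.QuantumFieldTheory.qcdTorusExpect (reg.β k) (2 * ⌊ℓ / (2 * reg.a k)⌋₊ + 1) (fun fl => (reg.scheme m 0 0).mq fl k) (fun U => (List.ofFn fun i : Fin n => (∑ x ∈ Literature.Probability.LatticeModels.box 4 ⌊ℓ / (2 * reg.a k)⌋₊, ((z (σ i) k * reg.a k ^ 4 * (f i) (reg.a k • Literature.MathematicalPhysics.QuantumLattice.siteToE x) : ℝ) : ℂ) • (Literature.MathematicalPhysics.QuantumFieldTheory.insertion U (σ i) x - algebraMap ℂ _ (((shift (σ i) k) : ℝ) : ℂ)))).prod)) atTop (nhds (W ℓ n σ f))) ∧ (∀ fl gl : Fin Nf, fl ≠ gl → ∃ f g : SchwartzMap (EuclideanSpace ℝ (Fin 4)) ℝ, tsupport f ⊆ {x | x 0 < 0} ∧ tsupport g ⊆ {x | 0 < x 0} ∧ W ℓ₀ 2 (fun _ => Literature.MathematicalPhysics.QuantumFieldTheory.QCDField.pseudoRe fl gl) ![f, g] ≠ W ℓ₀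 1 (fun _ => Literature.MathematicalPhysics.QuantumFieldTheory.QCDField.pseudoRe fl gl) ![f] * W ℓ₀ 1 (fun _ => Literature.MathematicalPhysics.QuantumFieldTheory.QCDField.pseudoRe fl gl) ![g]) ∧ ∀ s₀ : Literature.MathematicalPhysics.QuantumFieldTheory.QCDField Nf, s₀ = Literature.MathematicalPhysics.QuantumFieldTheory.QCDField.glue → (∃ f g : SchwartzMap (EuclideanSpace ℝ (Fin 4)) ℝ, tsupport f ⊆ {x | x 0 < 0} ∧ tsupport g ⊆ {x | 0 < x 0} ∧ W ℓ₀ 2 (fun _ => s₀) ![f, g] ≠ W ℓ₀ 1 (fun _ => s₀) ![f] * W ℓ₀ 1 (fun _ => s₀) ![g]) ∧ (∃ f g h : SchwartzMap (EuclideanSpace ℝ (Fin 4)) ℝ, Disjoint (tsupport f) (tsupport g) ∧ Disjoint (tsupport f) (tsupport h) ∧ Disjoint (tsupport g) (tsupport h) ∧ W ℓ₀ 3 (fun _ => s₀) ![f, g, h] - W ℓ₀ 1 (fun _ => s₀) ![f] * W ℓ₀ 2 (fun _ => s₀) ![g, h] - W ℓ₀ 1 (fun _ => s₀) ![g] * W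 ℓ₀ 2 (fun _ => s₀) ![f, h] - W ℓ₀ 1 (fun _ => s₀) ![h] * W ℓ₀ 2 (fun _ => s₀) ![f, g] + 2 * (W ℓ₀ 1 (fun _ => s₀) ![f] * W ℓ₀ 1 (fun _ => s₀) ![g] * W ℓ₀ 1 (fun _ => s₀) ![h]) ≠ 0)) := by
  sorry

/-- **Stub 2 — volume doubling of UV renormalisation** (StepExtension of the route's two-layer
plan: "UV control at `2ℓ` from `ℓ`"). For `N_f ∈ {2,3}`, every regularisation `reg` with mass
scaling, asymptotic scaling and `m_crit(k) > −1` eventually, every positive mass tuple `m`, all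
species renormalisations `(z, shift)`, every functional `W` and sizes `ℓ' = 2ℓ`, `ℓ > 0`: IF every
pairwise-disjoint-support smeared renormalised correlator converges on the tori of physical side
`ℓ` (to `W ℓ n σ f`), THEN with the SAME `(z, shift)` every such correlator converges on the tori of
physical side `2ℓ` (to some `W' n σ f`). Why plausibly true: composite-field renormalisation
(`z_s(k)`, `shift_s(k)`) is local — volume enters expectation values only through finite,
convergent finite-size effects (`z_glue·(⟨plaquette⟩_ℓ − ⟨plaquette⟩_{2ℓ})` is a difference of
vacuum energy densities in physical units) — so constants that renormalise one volume renormalise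
all; what must be supplied is a-uniform stability of the `2⁴`-times larger box, whose new coarse
modes live at the stronger coupling `g²(2ℓ)` (large-field problem; barrier
`UVStabilityNonUniqueness` met head-on, as the route header says). It may fail only through a
volume-specific accident: e.g. zeros of the `(−1)^F`-twisted partition function at side `2ℓ` along
infinitely many `k` (signed Wilson determinant) making `qcdTorusExpect` junk there while side `ℓ`
converges. Size: XL. Leans on: `qcdTorusExpect`, `QCDRegularisation.scheme`, `insertion`, `box`,
`siteToE` (tree); Balaban1989LargeFieldII, MagnenRivasseauSeneor1993, Luscher1983,
doi:10.1016/0550-3213(91)90298-c (finite volume as the scheme). -/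
theorem stub_volumeDoubling :
    ∀ Nf : ℕ, 2 ≤ Nf → Nf ≤ 3 → ∀ reg : Literature.MathematicalPhysics.QuantumFieldTheory.QCDRegularisation Nf, (reg.HasMassScaling ∧ (∃ Λ > 0, Tendsto (fun k => reg.β k - Literature.MathematicalPhysics.QuantumFieldTheory.afBeta Nf Λ (reg.a k)) atTop (nhds 0)) ∧ (∀ᶠ k in atTop, (-1 : ℝ) < reg.mcrit k)) → ∀ m : Fin Nf → ℝ, (∀ fl, 0 < m fl) → ∀ (z shift : Literature.MathematicalPhysics.QuantumFieldTheory.QCDField Nf → ℕ → ℝ) (W : ((ℓ : ℝ) → (n : ℕ) → (Fin n → Literature.MathematicalPhysics.QuantumFieldTheory.QCDField Nf) → (Fin n → SchwartzMap (EuclideanSpace ℝ (Fin 4)) ℝ) → ℂ)) (ℓ ℓ' : ℝ), 0 < ℓ → ℓ' = 2 * ℓ → (∀ (n : ℕ) (σ : Fin n → Literature.MathematicalPhysics.QuantumFieldTheory.QCDField Nf) (f : Fin n → SchwartzMap (EuclideanSpace ℝ (Fin 4)) ℝ), (∀ i j : Fin n, i ≠ j → Disjoint (tsupport (f i)) (tsupport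 (f j))) → Tendsto (fun k => Literature.MathematicalPhysics.QuantumFieldTheory.qcdTorusExpect (reg.β k) (2 * ⌊ℓ / (2 * reg.a k)⌋₊ + 1) (fun fl => (reg.scheme m 0 0).mq fl k) (fun U => (List.ofFn fun i : Fin n => (∑ x ∈ Literature.Probability.LatticeModels.box 4 ⌊ℓ / (2 * reg.a k)⌋₊, ((z (σ i) k * reg.a k ^ 4 * (f i) (reg.a k • Literature.MathematicalPhysics.QuantumLattice.siteToE x) : ℝ) : ℂ) • (Literature.MathematicalPhysics.QuantumFieldTheory.insertion U (σ i) x - algebraMap ℂ _ (((shift (σ i) k) : ℝ) : ℂ)))).prod)) atTop (nhds (W ℓ n σ f))) → ∃ W' : ((n : ℕ) → (Fin n → Literature.MathematicalPhysics.QuantumFieldTheory.QCDField Nf) → (Fin n → SchwartzMap (EuclideanSpace ℝ (Fin 4)) ℝ) → ℂ), ∀ (n : ℕ) (σ : Fin n → Literature.MathematicalPhysics.QuantumFieldTheory.QCDField Nf) (f : Fin n → SchwartzMap (EuclideanSpace ℝ (Fin 4)) ℝ), (∀ i j : Fin n, i ≠ j → Disjoint (tsupport (f i)) (tsupport (f j)))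 → Tendsto (fun k => Literature.MathematicalPhysics.QuantumFieldTheory.qcdTorusExpect (reg.β k) (2 * ⌊ℓ' / (2 * reg.a k)⌋₊ + 1) (fun fl => (reg.scheme m 0 0).mq fl k) (fun U => (List.ofFn fun i : Fin n => (∑ x ∈ Literature.Probability.LatticeModels.box 4 ⌊ℓ' / (2 * reg.a k)⌋₊, ((z (σ i) k * reg.a k ^ 4 * (f i) (reg.a k • Literature.MathematicalPhysics.QuantumLattice.siteToE x) : ℝ) : ℂ) • (Literature.MathematicalPhysics.QuantumFieldTheory.insertion U (σ i) x - algebraMap ℂ _ (((shift (σ i) k) : ℝ) : ℂ)))).prod)) atTop (nhds (W' n σ f)) := by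
  sorry

set_option maxHeartbeats 1600000 in
/-- **Assembly** — the two stubs imply the crux BY NAME. Dyadic induction on octaves: the base
octave `[ℓ₀, 2ℓ₀]` is Stub 1; octave `j+1` is obtained from octave `j` by applying Stub 2 at
`ℓ/2` (same `z, shift`; limit functionals chosen per `ℓ`); every `ℓ ≥ ℓ₀` lies in some octave
(Archimedean `exists_nat_pow_near`); the final functional is `W` on `[ℓ₀, 2ℓ₀]` (so N1–N3 at `ℓ₀`
transfer verbatim) and the chosen octave functional beyond. -/
theorem FiniteVolumeContinuumLimitC_of :
    (∀ Nf : ℕ, 2 ≤ Nf → Nf ≤ 3 → ∃ reg : Literature.MathematicalPhysics.QuantumFieldTheory.QCDRegularisation Nf, (reg.HasMassScaling ∧ (∃ Λ > 0, Tendsto (fun k => reg.β k - Literature.MathematicalPhysics.QuantumFieldTheory.afBeta Nf Λ (reg.a k)) atTop (nhds 0)) ∧ (∀ᶠ k in atTop, (-1 : ℝ) < reg.mcrit k)) ∧ reg.IsChiralAtZero ∧ (∀ m : Fin Nf → ℝ, (∀ fl, 0 < m fl) → ∃ z shift : Literature.MathematicalPhysics.QuantumFieldTheory.QCDField Nf →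 ℕ → ℝ, ∃ W : ((ℓ : ℝ) → (n : ℕ) → (Fin n → Literature.MathematicalPhysics.QuantumFieldTheory.QCDField Nf) → (Fin n → SchwartzMap (EuclideanSpace ℝ (Fin 4)) ℝ) → ℂ), ∃ ℓ₀ > 0, (∀ ℓ : ℝ, ℓ₀ ≤ ℓ → ℓ ≤ 2 * ℓ₀ → ∀ (n : ℕ) (σ : Fin n → Literature.MathematicalPhysics.QuantumFieldTheory.QCDField Nf) (f : Fin n → SchwartzMap (EuclideanSpace ℝ (Fin 4)) ℝ), (∀ i j : Fin n, i ≠ j → Disjoint (tsupport (f i)) (tsupport (f j))) → Tendsto (fun k => Literature.MathematicalPhysics.QuantumFieldTheory.qcdTorusExpect (reg.β k) (2 * ⌊ℓ / (2 * reg.a k)⌋₊ + 1) (fun fl => (reg.scheme m 0 0).mq fl k) (fun U => (List.ofFn fun i : Fin n => (∑ x ∈ Literature.Probability.LatticeModels.box 4 ⌊ℓ / (2 * reg.a k)⌋₊, ((z (σ i) k * reg.a k ^ 4 * (f i) (reg.a k • Literature.MathematicalPhysics.QuantumLattice.siteToE x) : ℝ) : ℂ) • (Literature.MathematicalPhysics.QuantumFieldTheory.insertion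 U (σ i) x - algebraMap ℂ _ (((shift (σ i) k) : ℝ) : ℂ)))).prod)) atTop (nhds (W ℓ n σ f))) ∧ (∀ fl gl : Fin Nf, fl ≠ gl → ∃ f g : SchwartzMap (EuclideanSpace ℝ (Fin 4)) ℝ, tsupport f ⊆ {x | x 0 < 0} ∧ tsupport g ⊆ {x | 0 < x 0} ∧ W ℓ₀ 2 (fun _ => Literature.MathematicalPhysics.QuantumFieldTheory.QCDField.pseudoRe fl gl) ![f, g] ≠ W ℓ₀ 1 (fun _ => Literature.MathematicalPhysics.QuantumFieldTheory.QCDField.pseudoRe fl gl) ![f] * W ℓ₀ 1 (fun _ => Literature.MathematicalPhysics.QuantumFieldTheory.QCDField.pseudoRe fl gl) ![g]) ∧ ∀ s₀ : Literature.MathematicalPhysics.QuantumFieldTheory.QCDField Nf, s₀ = Literature.MathematicalPhysics.QuantumFieldTheory.QCDField.glue → (∃ f g : SchwartzMap (EuclideanSpace ℝ (Fin 4)) ℝ, tsupport f ⊆ {x | x 0 < 0} ∧ tsupport g ⊆ {x | 0 < x 0} ∧ W ℓ₀ 2 (fun _ => s₀) ![f, g] ≠ W ℓ₀ 1 (fun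 _ => s₀) ![f] * W ℓ₀ 1 (fun _ => s₀) ![g]) ∧ (∃ f g h : SchwartzMap (EuclideanSpace ℝ (Fin 4)) ℝ, Disjoint (tsupport f) (tsupport g) ∧ Disjoint (tsupport f) (tsupport h) ∧ Disjoint (tsupport g) (tsupport h) ∧ W ℓ₀ 3 (fun _ => s₀) ![f, g, h] - W ℓ₀ 1 (fun _ => s₀) ![f] * W ℓ₀ 2 (fun _ => s₀) ![g, h] - W ℓ₀ 1 (fun _ => s₀) ![g] * W ℓ₀ 2 (fun _ => s₀) ![f, h] - W ℓ₀ 1 (fun _ => s₀) ![h] * W ℓ₀ 2 (fun _ => s₀) ![f, g] + 2 * (W ℓ₀ 1 (fun _ => s₀) ![f] * W ℓ₀ 1 (fun _ => s₀) ![g] * W ℓ₀ 1 (fun _ => s₀) ![h]) ≠ 0))) →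
    (∀ Nf : ℕ, 2 ≤ Nf → Nf ≤ 3 → ∀ reg : Literature.MathematicalPhysics.QuantumFieldTheory.QCDRegularisation Nf, (reg.HasMassScaling ∧ (∃ Λ > 0, Tendsto (fun k => reg.β k - Literature.MathematicalPhysics.QuantumFieldTheory.afBeta Nf Λ (reg.a k)) atTop (nhds 0)) ∧ (∀ᶠ k in atTop, (-1 : ℝ) < reg.mcrit k)) → ∀ m : Fin Nf → ℝ, (∀ fl, 0 < m fl) → ∀ (z shift : Literature.MathematicalPhysics.QuantumFieldTheory.QCDField Nf → ℕ → ℝ) (W : ((ℓ : ℝ) → (n : ℕ) → (Fin n → Literature.MathematicalPhysics.QuantumFieldTheory.QCDField Nf) → (Fin n → SchwartzMap (EuclideanSpace ℝ (Fin 4)) ℝ) → ℂ)) (ℓ ℓ' : ℝ), 0 < ℓ → ℓ' = 2 * ℓ → (∀ (n : ℕ) (σ : Fin n → Literature.MathematicalPhysics.QuantumFieldTheory.QCDField Nf) (f : Fin n → SchwartzMap (EuclideanSpace ℝ (Fin 4)) ℝ), (∀ i j : Fin n, i ≠ j → Disjoint (tsupport (f i)) (tsupport (f j))) → Tendsto (fun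 k => Literature.MathematicalPhysics.QuantumFieldTheory.qcdTorusExpect (reg.β k) (2 * ⌊ℓ / (2 * reg.a k)⌋₊ + 1) (fun fl => (reg.scheme m 0 0).mq fl k) (fun U => (List.ofFn fun i : Fin n => (∑ x ∈ Literature.Probability.LatticeModels.box 4 ⌊ℓ / (2 * reg.a k)⌋₊, ((z (σ i) k * reg.a k ^ 4 * (f i) (reg.a k • Literature.MathematicalPhysics.QuantumLattice.siteToE x) : ℝ) : ℂ) • (Literature.MathematicalPhysics.QuantumFieldTheory.insertion U (σ i) x - algebraMap ℂ _ (((shift (σ i) k) : ℝ) : ℂ)))).prod)) atTop (nhds (W ℓ n σ f))) → ∃ W' : ((n : ℕ) → (Fin n → Literature.MathematicalPhysics.QuantumFieldTheory.QCDField Nf) → (Fin n → SchwartzMap (EuclideanSpace ℝ (Fin 4)) ℝ) → ℂ), ∀ (n : ℕ) (σ : Fin n → Literature.MathematicalPhysics.QuantumFieldTheory.QCDField Nf) (f : Fin n → SchwartzMap (EuclideanSpace ℝ (Fin 4)) ℝ), (∀ i j : Fin n, i ≠ j → Disjoint (tsupport (f i)) (tsupport (f j))) → Tendsto (fun k =>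 Literature.MathematicalPhysics.QuantumFieldTheory.qcdTorusExpect (reg.β k) (2 * ⌊ℓ' / (2 * reg.a k)⌋₊ + 1) (fun fl => (reg.scheme m 0 0).mq fl k) (fun U => (List.ofFn fun i : Fin n => (∑ x ∈ Literature.Probability.LatticeModels.box 4 ⌊ℓ' / (2 * reg.a k)⌋₊, ((z (σ i) k * reg.a k ^ 4 * (f i) (reg.a k • Literature.MathematicalPhysics.QuantumLattice.siteToE x) : ℝ) : ℂ) • (Literature.MathematicalPhysics.QuantumFieldTheory.insertion U (σ i) x - algebraMap ℂ _ (((shift (σ i) k) : ℝ) : ℂ)))).prod)) atTop (nhds (W' n σ f))) →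
    Summit.QuantumFields.QCD.Theses.FemtoStepScaling.FiniteVolumeContinuumLimitC := by
  intro hF hE Nf hNf2 hNf3
  obtain ⟨reg, hgood, hchi, hUV⟩ := hF Nf hNf2 hNf3
  refine ⟨reg, hgood, hchi, ?_⟩
  intro m hm
  obtain ⟨z, shift, W, ℓ₀, hℓ₀, hwin, hN2, hN13⟩ := hUV m hm
  -- (1) dyadic octaves: `j` doublings of the base octave
  have claim : ∀ j : ℕ, ∃ Wj : ((ℓ : ℝ) → (n : ℕ) → (Fin n → Literature.MathematicalPhysics.QuantumFieldTheory.QCDField Nf) → (Fin n → SchwartzMap (EuclideanSpace ℝ (Fin 4)) ℝ) → ℂ),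
      ∀ ℓ : ℝ, (2 : ℝ) ^ j * ℓ₀ ≤ ℓ → ℓ ≤ (2 : ℝ) ^ (j + 1) * ℓ₀ →
        ∀ (n : ℕ) (σ : Fin n → Literature.MathematicalPhysics.QuantumFieldTheory.QCDField Nf) (f : Fin n → SchwartzMap (EuclideanSpace ℝ (Fin 4)) ℝ), (∀ i j : Fin n, i ≠ j → Disjoint (tsupport (f i)) (tsupport (f j))) → Tendsto (fun k => Literature.MathematicalPhysics.QuantumFieldTheory.qcdTorusExpect (reg.β k) (2 * ⌊ℓ / (2 * reg.a k)⌋₊ + 1) (fun fl => (reg.scheme m 0 0).mq fl k) (fun U => (List.ofFn fun i : Fin n => (∑ x ∈ Literature.Probability.LatticeModels.box 4 ⌊ℓ / (2 * reg.a k)⌋₊, ((z (σ i) k * reg.a k ^ 4 * (f i) (reg.a k • Literature.MathematicalPhysics.QuantumLattice.siteToE x) : ℝ) : ℂ) • (Literature.MathematicalPhysics.QuantumFieldTheory.insertion U (σ i) x - algebraMap ℂ _ (((shift (σ i) k) : ℝ) : ℂ)))).prod)) atTop (nhds (Wj ℓ n σ f)) := by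
    intro j
    induction j with
    | zero =>
      refine ⟨W, fun ℓ hlo hhi => hwin ℓ ?_ ?_⟩
      · simpa using hlo
      · have e : (2 : ℝ) ^ (0 + 1) * ℓ₀ = 2 * ℓ₀ := by norm_num
        rw [e] at hhi
        exact hhi
    | succ j ih =>
      obtain ⟨Wj, hWj⟩ := ih
      have step : ∀ ℓ : ℝ, (2 : ℝ) ^ (j + 1) * ℓ₀ ≤ ℓ → ℓ ≤ (2 : ℝ) ^ (j + 1 + 1) * ℓ₀ →
          ∃ W' : ((n : ℕ) → (Fin n → Literature.MathematicalPhysics.QuantumFieldTheory.QCDField Nf) → (Fin n → SchwartzMap (EuclideanSpace ℝ (Fin 4)) ℝ) → ℂ),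
            ∀ (n : ℕ) (σ : Fin n → Literature.MathematicalPhysics.QuantumFieldTheory.QCDField Nf) (f : Fin n → SchwartzMap (EuclideanSpace ℝ (Fin 4)) ℝ), (∀ i j : Fin n, i ≠ j → Disjoint (tsupport (f i)) (tsupport (f j))) → Tendsto (fun k => Literature.MathematicalPhysics.QuantumFieldTheory.qcdTorusExpect (reg.β k) (2 * ⌊ℓ / (2 * reg.a k)⌋₊ + 1) (fun fl => (reg.scheme m 0 0).mq fl k) (fun U => (List.ofFn fun i : Fin n => (∑ x ∈ Literature.Probability.LatticeModels.box 4 ⌊ℓ / (2 * reg.a k)⌋₊, ((z (σ i) k * reg.a k ^ 4 * (f i) (reg.a k • Literature.MathematicalPhysics.QuantumLattice.siteToE x) : ℝ) : ℂ) • (Literature.MathematicalPhysics.QuantumFieldTheory.insertion U (σ i) x - algebraMap ℂ _ (((shift (σ i) k) : ℝ) : ℂ)))).prod)) atTop (nhds (W' n σ f)) := by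
        intro ℓ hlo hhi
        have hpos : (0 : ℝ) < (2 : ℝ) ^ (j + 1) * ℓ₀ := mul_pos (pow_pos two_pos _) hℓ₀
        refine hE Nf hNf2 hNf3 reg hgood m hm z shift Wj (ℓ / 2) ℓ (by linarith) (by ring)
          (hWj (ℓ / 2) ?_ ?_)
        · calc (2 : ℝ) ^ j * ℓ₀ = (2 : ℝ) ^ (j + 1) * ℓ₀ / 2 := by ring
            _ ≤ ℓ / 2 := by linarith
        · calc ℓ / 2 ≤ (2 : ℝ) ^ (j + 1 + 1) * ℓ₀ / 2 := by linarith
            _ = (2 : ℝ) ^ (j + 1) * ℓ₀ := by ring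
      choose! Wsel hWsel using step
      exact ⟨fun ℓ => Wsel ℓ, fun ℓ hlo hhi => hWsel ℓ hlo hhi⟩
  -- (2) every `ℓ ≥ ℓ₀` lies in an octave
  have cover : ∀ ℓ : ℝ, ℓ₀ ≤ ℓ → ∃ j : ℕ, (2 : ℝ) ^ j * ℓ₀ ≤ ℓ ∧ ℓ ≤ (2 : ℝ) ^ (j + 1) * ℓ₀ := by
    intro ℓ hℓ
    have hx : (1 : ℝ) ≤ ℓ / ℓ₀ := by
      rw [le_div_iff₀ hℓ₀, one_mul]
      exact hℓ
    obtain ⟨j, hj1, hj2⟩ := exists_nat_pow_near hx one_lt_two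
    exact ⟨j, (le_div_iff₀ hℓ₀).mp hj1, le_of_lt ((div_lt_iff₀ hℓ₀).mp hj2)⟩
  choose Wfun hWfun using claim
  choose! jsel hjsel using cover
  have h2ℓ₀ : ℓ₀ ≤ 2 * ℓ₀ := by linarith
  -- (3) glue: `W` on the base octave, the chosen octave functional beyond
  obtain ⟨W'', hW1, hW2⟩ : ∃ W'' : ((ℓ : ℝ) → (n : ℕ) → (Fin n → Literature.MathematicalPhysics.QuantumFieldTheory.QCDField Nf) → (Fin n → SchwartzMap (EuclideanSpace ℝ (Fin 4)) ℝ) → ℂ),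
      (∀ ℓ : ℝ, ℓ ≤ 2 * ℓ₀ → W'' ℓ = W ℓ) ∧ (∀ ℓ : ℝ, ¬ ℓ ≤ 2 * ℓ₀ → W'' ℓ = Wfun (jsel ℓ) ℓ) :=
    ⟨fun ℓ => if ℓ ≤ 2 * ℓ₀ then W ℓ else Wfun (jsel ℓ) ℓ, fun ℓ h => if_pos h, fun ℓ h => if_neg h⟩
  refine ⟨z, shift, W'', ℓ₀, hℓ₀, ?_, ?_, ?_⟩
  · intro ℓ hℓ n σ f hf
    by_cases hle : ℓ ≤ 2 * ℓ₀
    · rw [hW1 ℓ hle]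
      exact hwin ℓ hℓ hle n σ f hf
    · rw [hW2 ℓ hle]
      exact hWfun (jsel ℓ) ℓ (hjsel ℓ hℓ).1 (hjsel ℓ hℓ).2 n σ f hf
  · intro fl gl hfg
    obtain ⟨f, g, hf, hg, hne⟩ := hN2 fl gl hfg
    refine ⟨ℓ₀, le_rfl, f, g, hf, hg, ?_⟩
    rw [hW1 ℓ₀ h2ℓ₀]
    exact hne
  · intro s₀ hs₀
    obtain ⟨⟨f, g, hf, hg, hne⟩, ⟨f', g', h', d1, d2, d3, hne3⟩⟩ := hN13 s₀ hs₀
    refine ⟨⟨ℓ₀, le_rfl, f, g, hf, hg, ?_⟩, ⟨ℓ₀, le_rfl, f', g', h', d1, d2, d3, ?_⟩⟩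
    · rw [hW1 ℓ₀ h2ℓ₀]
      exact hne
    · rw [hW1 ℓ₀ h2ℓ₀]
      exact hne3

/-- **The skeleton IS the crux proof modulo the registered stubs**: `FiniteVolumeContinuumLimitC` by
name, from `stub_femtoWindowPinned` and `stub_volumeDoubling` through `FiniteVolumeContinuumLimitC_of`
(sorries live only inside the two stubs; this theorem becomes the crux proof when both land). -/
theorem FiniteVolumeContinuumLimitC_skeleton :
    Summit.QuantumFields.QCD.Theses.FemtoStepScaling.FiniteVolumeContinuumLimitC :=
  FiniteVolumeContinuumLimitC_of stub_femtoWindowPinned stub_volumeDoubling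

end Summit.QuantumFields.QCD.Cruxes.FiniteVolumeContinuumLimitC.Birth
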